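import Summits.CriticalPhenomena.PercolationContinuityZ3.Theorems.PercAnnulusCrossingIICArmForgetsRoot
import Summits.CriticalPhenomena.PercolationContinuityZ3.Theorems.PercAnnulusCrossingIICRootedVertex
import HarnessLib

/-!
# RATIO LIMITS FOR ARMS FROM ARBITRARY FINITE SOURCES: `P_p(X ↔ ∂ⁱⁿΛ(n) off H)/π_p(n) → ν_{x₀}(C_K)/P_p(C_K)` (lane RSW3, p1 gen 10)

builds on p205010 (kernel theorem, internal audit signed; external expert review pending) — used only through `θ(p_c) = 0` in the
`criticalProbI` / `ℤ²` corollaries; the main theorems are stated at any `p` with `θ(p) = 0` and (A2)□ at aspect `(s, L)`, `2 ≤ s`.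

Seat `prim-rsw3-p1` (gen 10); memo `run/shared/lean/prim/rsw3/P1-QM.md` §23.  Helper file; no definitions, no sorries.

p1 gen 8 (`…IICRooted`, `…IICRootedVertex`) proved the finite-volume identity `P_p(X ↔ ∂ⁱⁿΛ(n) off H) · P_p(C_K) = P_p(C_K ∩ A_n(x₀))` for a finite source `X`
connected through its internal lattice edges `G`, an obstacle `H` with lattice edges `F` (`K = F ∪ G`, `C_K = {F closed, G open}`) and ANY root `x₀ ∈ X`
(`A_n(x₀) = {x₀ ↔ ∂ⁱⁿΛ(n) in Λ(n)}`), and drew the IIC limits for roots `X ∋ 0` — for a general root `x₀` only conditionally on "an IIC measure at `x₀` along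
`Λ(n)`".  Gen 10's `…IICArmForgetsRoot` supplies that measure (`tendsto_cond_arm_at_of_iicMeasure`: it is `ν_{x₀} = (U_{x₀})_* ν`) AND `π_n(x₀)/π(n) → 1`, so:

* **`tendsto_real_conn_div_oneArmProb_at`** — `θ(p) = 0`, (A2)□ at aspect `(s,L)`, `ν` an IIC probability measure: for EVERY finite connected source `X`, every
  root `x₀ ∈ X`, every obstacle `H` with `P_p(C_K) > 0`:  **`P_p(X ↔ ∂ⁱⁿΛ(n) off H) / π_p(n) → ν_{x₀}(C_K) / P_p(C_K)`** — every 'arm from a finite source off an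
  obstacle' is asymptotically an explicit constant multiple of the one-arm probability (gen 8 had this for sources through the origin); the constant does not depend
  on the root `x₀ ∈ X` chosen to express it;
* **`tendsto_real_inter_conn_div_real_conn_at_of_iicMeasure`** — the rooted IIC limit `P_p(E | X ↔ ∂ⁱⁿΛ(n) off H) → ν_{x₀}(E ∩ C_K)/ν_{x₀}(C_K)` for every cylinder `E` off
  `K` (gen 8's `tendsto_real_inter_conn_div_real_conn_at` with its measure hypothesis discharged), when `ν_{x₀}(C_K) > 0`;
* `tendsto_real_conn_div_oneArmProb_at_criticalProbI`, `…_Z2`.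
References: H. Kesten, PTRF 73 (1986) Thm. (3); D. Basu, A. Sapozhnikov, ECP 22 (2017) no. 26, Thm. 1.1, Remark 2.1; A. Járai, Ann. Probab. 31 (2003).
-/

noncomputable section

namespace Summit.CriticalPhenomena.PercolationContinuityZ3.Theorems.Crossing

open MeasureTheory Filter Topology Literature.Probability.Percolation Literature.Probability.LatticeModels
open Literature.Probability.Percolation.DCT16
open Summit.CriticalPhenomena.PercolationContinuityZ3.Theorems.SurfaceTension
open scoped Literature.Probability.Percolation ENNReal

variable {d : ℕ}

/-- **RATIO LIMIT FOR ARMS FROM ARBITRARY FINITE SOURCES**: `θ(p) = 0`, (A2)□ at aspect `(s, L)` (`2 ≤ s`), `ν` an IIC probability measure at `p` (`0 < p`,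
`d ≥ 1`); `X` a finite source connected through its internal lattice edges `G`, `x₀ ∈ X` any root, `H` an obstacle with lattice edges `F`, `C_K = {F closed, G open}`
with `P_p(C_K) > 0` ⇒ **`P_p(X ↔ ∂ⁱⁿΛ(n) in Λ(n) ∖ H) / π_p(n) → ν_{x₀}(C_K) / P_p(C_K)`**, `ν_{x₀} = (U_{x₀})_* ν`.
[cite: BasuSapozhnikov2017ECP, Thm. 1.1 and Remark 2.1] [cite: Kesten1986, Thm. (3)] -/
theorem tendsto_real_conn_div_oneArmProb_at (hd : 1 ≤ d) (p : unitInterval) (hp : 0 < (p : ℝ)) (hθ : theta (zdGraph d) 0 p = 0)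
    {s L : ℕ} (hs : 2 ≤ s) {ϰ : ℝ} (hϰ : 0 < ϰ) (hA2 : SetToSetQuasiMultAspectAt d p s L ϰ)
    {ν : Measure (BondConfig (Site d))} [IsProbabilityMeasure ν]
    (hν : ∀ (F : Finset (Sym2 (Site d))) (E : Set (BondConfig (Site d))), MeasurableSet E → DeterminedBy E ↑F →
      Tendsto (fun n : ℕ => (bondPercolation (zdGraph d) p).real (E ∩ siteToBoundary d n) / oneArmProb d p n)
        atTop (𝓝 (ν.real E)))
    {H X : Finset (Site d)} {F G : Finset (Sym2 (Site d))}
    (hF : ∀ e, e ∈ F ↔ e ∈ (zdGraph d).edgeSet ∧ ∃ h ∈ H, h ∈ e)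
    (hG : ∀ e, e ∈ G ↔ e ∈ (zdGraph d).edgeSet ∧ ∀ v ∈ e, v ∈ X)
    {x₀ : Site d} (hX0 : x₀ ∈ X) (hXconn : ∀ x ∈ X, PathIn (zdGraph d) (↑X : Set (Site d)) x₀ x) {m : ℕ} (hXm : X ⊆ box d m)
    (hC : 0 < (bondPercolation (zdGraph d) p).real {ω : BondConfig (Site d) | (∀ e ∈ F, e ∉ ω) ∧ ∀ e ∈ G, e ∈ ω}) :
    Tendsto (fun n : ℕ => (bondPercolation (zdGraph d) p).real {ω : BondConfig (Site d) | ∃ x ∈ X, ∃ t ∈ innerBoundary (zdGraph d) (box d n),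
        ω ∈ openConnIn ((↑(box d n) : Set (Site d)) \ ↑H) x t} / oneArmProb d p n)
      atTop (𝓝 ((ν.map (BondConfig.relabel (sym2Equiv (Site.shift x₀)))).real {ω : BondConfig (Site d) | (∀ e ∈ F, e ∉ ω) ∧ ∀ e ∈ G, e ∈ ω} /
        (bondPercolation (zdGraph d) p).real {ω : BondConfig (Site d) | (∀ e ∈ F, e ∉ ω) ∧ ∀ e ∈ G, e ∈ ω})) := by
  classical
  set P := bondPercolation (zdGraph d) p with hP
  set C : Set (BondConfig (Site d)) := {ω | (∀ e ∈ F, e ∉ ω) ∧ ∀ e ∈ G, e ∈ ω} with hCdef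
  have hCdet : DeterminedBy C (↑(F ∪ G) : Set (Sym2 (Site d))) := determinedBy_cyl F G
  have hCm : MeasurableSet C := hCdet.measurableSet_of_finset
  -- `P(C ∩ A_n(x₀))/π_n(x₀) → ν_{x₀}(C)` and `π_n(x₀)/π(n) → 1`
  have h1 := tendsto_cond_arm_at_of_iicMeasure hd p hp hθ hs hϰ hA2 hν x₀ hCm hCdet
  have h2 := tendsto_arm_at_div_oneArmProb hd p hp hθ hs hϰ hA2 hν x₀
  have h12 := h1.mul h2
  rw [mul_one] at h12
  -- hence `P(C ∩ A_n(x₀))/π(n) → ν_{x₀}(C)`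
  have h3 : Tendsto (fun n : ℕ => P.real (C ∩ {ω : BondConfig (Site d) | ∃ t ∈ innerBoundary (zdGraph d) (box d n),
      ω ∈ openConnIn (↑(box d n) : Set (Site d)) x₀ t}) / oneArmProb d p n) atTop
      (𝓝 ((ν.map (BondConfig.relabel (sym2Equiv (Site.shift x₀)))).real C)) := by
    refine h12.congr' ?_
    filter_upwards [h2.eventually_const_lt (by norm_num : (1 : ℝ) / 2 < 1)] with n hn
    have hπv : P.real {ω : BondConfig (Site d) | ∃ t ∈ innerBoundary (zdGraph d) (box d n),
        ω ∈ openConnIn (↑(box d n) : Set (Site d)) x₀ t} ≠ 0 := by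
      intro h0
      rw [hP] at h0
      rw [h0, zero_div] at hn
      linarith
    rw [hP] at hπv
    exact div_mul_div_cancel₀ hπv
  -- and `P(CONN) = P(C ∩ A_n(x₀))/P(C)` for `n > m`
  have h4 : Tendsto (fun n : ℕ => P.real (C ∩ {ω : BondConfig (Site d) | ∃ t ∈ innerBoundary (zdGraph d) (box d n),
      ω ∈ openConnIn (↑(box d n) : Set (Site d)) x₀ t}) / oneArmProb d p n / P.real C) atTop
      (𝓝 ((ν.map (BondConfig.relabel (sym2Equiv (Site.shift x₀)))).real C / P.real C)) := h3.div_const _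
  refine h4.congr' ?_
  filter_upwards [eventually_gt_atTop m] with n hn
  have hid := real_conn_mul_real_cyl_eq_at p hF hG hX0 hXconn hXm hn
  rw [← hP] at hid
  have hid' : P.real {ω : BondConfig (Site d) | ∃ x ∈ X, ∃ t ∈ innerBoundary (zdGraph d) (box d n),
      ω ∈ openConnIn ((↑(box d n) : Set (Site d)) \ ↑H) x t} =
      P.real (C ∩ {ω : BondConfig (Site d) | ∃ t ∈ innerBoundary (zdGraph d) (box d n),
        ω ∈ openConnIn (↑(box d n) : Set (Site d)) x₀ t}) / P.real C := by
    rw [eq_div_iff hC.ne']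
    exact hid
  rw [hid', div_right_comm]

/-- **The rooted IIC limit at a general root, unconditionally in the measure**: with the data above and `ν_{x₀}(C_K) > 0`, for every cylinder event `E`
determined off `K = F ∪ G`: **`P_p(E | X ↔ ∂ⁱⁿΛ(n) off H) → ν_{x₀}(E ∩ C_K) / ν_{x₀}(C_K)`** — p1 gen 8's `tendsto_real_inter_conn_div_real_conn_at` with its hypothesis
"an IIC measure at `x₀` along `Λ(n)`" discharged by `ν_{x₀} = (U_{x₀})_* ν` (`tendsto_cond_arm_at_of_iicMeasure`).
[cite: BasuSapozhnikov2017ECP, Thm. 1.1 and Remark 2.1] [cite: Kesten1986, Thm. (3)] -/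
theorem tendsto_real_inter_conn_div_real_conn_at_of_iicMeasure (hd : 1 ≤ d) (p : unitInterval) (hp : 0 < (p : ℝ))
    (hθ : theta (zdGraph d) 0 p = 0) {s L : ℕ} (hs : 2 ≤ s) {ϰ : ℝ} (hϰ : 0 < ϰ) (hA2 : SetToSetQuasiMultAspectAt d p s L ϰ)
    {ν : Measure (BondConfig (Site d))} [IsProbabilityMeasure ν]
    (hν : ∀ (F : Finset (Sym2 (Site d))) (E : Set (BondConfig (Site d))), MeasurableSet E → DeterminedBy E ↑F →
      Tendsto (fun n : ℕ => (bondPercolation (zdGraph d) p).real (E ∩ siteToBoundary d n) / oneArmProb d p n)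
        atTop (𝓝 (ν.real E)))
    {H X : Finset (Site d)} {F G : Finset (Sym2 (Site d))}
    (hF : ∀ e, e ∈ F ↔ e ∈ (zdGraph d).edgeSet ∧ ∃ h ∈ H, h ∈ e)
    (hG : ∀ e, e ∈ G ↔ e ∈ (zdGraph d).edgeSet ∧ ∀ v ∈ e, v ∈ X)
    {x₀ : Site d} (hX0 : x₀ ∈ X) (hXconn : ∀ x ∈ X, PathIn (zdGraph d) (↑X : Set (Site d)) x₀ x) {m : ℕ} (hXm : X ⊆ box d m)
    (hC : 0 < (bondPercolation (zdGraph d) p).real {ω : BondConfig (Site d) | (∀ e ∈ F, e ∉ ω) ∧ ∀ e ∈ G, e ∈ ω})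
    (hνC : 0 < (ν.map (BondConfig.relabel (sym2Equiv (Site.shift x₀)))).real {ω : BondConfig (Site d) | (∀ e ∈ F, e ∉ ω) ∧ ∀ e ∈ G, e ∈ ω})
    {E : Set (BondConfig (Site d))} {T : Finset (Sym2 (Site d))} (hE : DeterminedBy E ↑T) (hT : Disjoint T (F ∪ G)) :
    Tendsto (fun n : ℕ => (bondPercolation (zdGraph d) p).real (E ∩ {ω : BondConfig (Site d) | ∃ x ∈ X, ∃ t ∈ innerBoundary (zdGraph d) (box d n),
        ω ∈ openConnIn ((↑(box d n) : Set (Site d)) \ ↑H) x t}) /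
        (bondPercolation (zdGraph d) p).real {ω : BondConfig (Site d) | ∃ x ∈ X, ∃ t ∈ innerBoundary (zdGraph d) (box d n),
        ω ∈ openConnIn ((↑(box d n) : Set (Site d)) \ ↑H) x t})
      atTop (𝓝 ((ν.map (BondConfig.relabel (sym2Equiv (Site.shift x₀)))).real (E ∩ {ω : BondConfig (Site d) | (∀ e ∈ F, e ∉ ω) ∧ ∀ e ∈ G, e ∈ ω}) /
        (ν.map (BondConfig.relabel (sym2Equiv (Site.shift x₀)))).real {ω : BondConfig (Site d) | (∀ e ∈ F, e ∉ ω) ∧ ∀ e ∈ G, e ∈ ω})) := by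
  haveI : IsProbabilityMeasure (ν.map (BondConfig.relabel (sym2Equiv (Site.shift x₀)))) := isProbabilityMeasure_iicMeasure_map_shift x₀
  exact tendsto_real_inter_conn_div_real_conn_at p (fun F' E' hE'm hE' => tendsto_cond_arm_at_of_iicMeasure hd p hp hθ hs hϰ hA2 hν x₀ hE'm hE')
    hF hG hX0 hXconn hXm hC hνC hE hT

/-- **Ratio limit for arms from finite sources at `p_c(ℤ^d)`** (`d ≥ 2`, (A2)□ at aspect `(s, L)`, `2 ≤ s`): `P_{p_c}(X ↔ ∂ⁱⁿΛ(n) off H)/π_{p_c}(n) →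
ν_{x₀}(C_K)/P_{p_c}(C_K)`. [cite: BasuSapozhnikov2017ECP, Thm. 1.1 and Remark 2.1] [cite: Kesten1986, Thm. (3)] -/
theorem tendsto_real_conn_div_oneArmProb_at_criticalProbI (hd : 2 ≤ d) {s L : ℕ} (hs : 2 ≤ s) {ϰ : ℝ} (hϰ : 0 < ϰ)
    (hA2 : SetToSetQuasiMultAspectAt d (criticalProbI d) s L ϰ)
    {ν : Measure (BondConfig (Site d))} [IsProbabilityMeasure ν]
    (hν : ∀ (F : Finset (Sym2 (Site d))) (E : Set (BondConfig (Site d))), MeasurableSet E → DeterminedBy E ↑F →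
      Tendsto (fun n : ℕ => (bondPercolation (zdGraph d) (criticalProbI d)).real (E ∩ siteToBoundary d n) /
        oneArmProb d (criticalProbI d) n) atTop (𝓝 (ν.real E)))
    {H X : Finset (Site d)} {F G : Finset (Sym2 (Site d))}
    (hF : ∀ e, e ∈ F ↔ e ∈ (zdGraph d).edgeSet ∧ ∃ h ∈ H, h ∈ e)
    (hG : ∀ e, e ∈ G ↔ e ∈ (zdGraph d).edgeSet ∧ ∀ v ∈ e, v ∈ X)
    {x₀ : Site d} (hX0 : x₀ ∈ X) (hXconn : ∀ x ∈ X, PathIn (zdGraph d) (↑X : Set (Site d)) x₀ x) {m : ℕ} (hXm : X ⊆ box d m)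
    (hC : 0 < (bondPercolation (zdGraph d) (criticalProbI d)).real {ω : BondConfig (Site d) | (∀ e ∈ F, e ∉ ω) ∧ ∀ e ∈ G, e ∈ ω}) :
    Tendsto (fun n : ℕ => (bondPercolation (zdGraph d) (criticalProbI d)).real {ω : BondConfig (Site d) | ∃ x ∈ X,
        ∃ t ∈ innerBoundary (zdGraph d) (box d n), ω ∈ openConnIn ((↑(box d n) : Set (Site d)) \ ↑H) x t} / oneArmProb d (criticalProbI d) n)
      atTop (𝓝 ((ν.map (BondConfig.relabel (sym2Equiv (Site.shift x₀)))).real {ω : BondConfig (Site d) | (∀ e ∈ F, e ∉ ω) ∧ ∀ e ∈ G, e ∈ ω} /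
        (bondPercolation (zdGraph d) (criticalProbI d)).real {ω : BondConfig (Site d) | (∀ e ∈ F, e ∉ ω) ∧ ∀ e ∈ G, e ∈ ω})) := by
  have hpc : 0 < ((criticalProbI d : unitInterval) : ℝ) := by
    exact_mod_cast Literature.Barriers.CriticalPhenomena.criticalProbI_pos' (d := d) (by omega)
  exact tendsto_real_conn_div_oneArmProb_at (by omega) (criticalProbI d) hpc (CSH.percolationContinuity_allDimensions d hd) hs hϰ hA2 hν
    hF hG hX0 hXconn hXm hC

/-- **Ratio limit for arms from finite sources on `ℤ²`, unconditionally** (given any measure `ν` with Kesten's IIC limit property at `p_c(ℤ²)`; such `ν` exists).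
[cite: Kesten1986, Thm. (3)] [cite: Jarai2003, Thm. 1] -/
theorem tendsto_real_conn_div_oneArmProb_at_Z2 {ν : Measure (BondConfig (Site 2))} [IsProbabilityMeasure ν]
    (hν : ∀ (F : Finset (Sym2 (Site 2))) (E : Set (BondConfig (Site 2))), MeasurableSet E → DeterminedBy E ↑F →
      Tendsto (fun n : ℕ => (bondPercolation (zdGraph 2) (criticalProbI 2)).real (E ∩ siteToBoundary 2 n) /
        oneArmProb 2 (criticalProbI 2) n) atTop (𝓝 (ν.real E)))
    {H X : Finset (Site 2)} {F G : Finset (Sym2 (Site 2))}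
    (hF : ∀ e, e ∈ F ↔ e ∈ (zdGraph 2).edgeSet ∧ ∃ h ∈ H, h ∈ e)
    (hG : ∀ e, e ∈ G ↔ e ∈ (zdGraph 2).edgeSet ∧ ∀ v ∈ e, v ∈ X)
    {x₀ : Site 2} (hX0 : x₀ ∈ X) (hXconn : ∀ x ∈ X, PathIn (zdGraph 2) (↑X : Set (Site 2)) x₀ x) {m : ℕ} (hXm : X ⊆ box 2 m)
    (hC : 0 < (bondPercolation (zdGraph 2) (criticalProbI 2)).real {ω : BondConfig (Site 2) | (∀ e ∈ F, e ∉ ω) ∧ ∀ e ∈ G, e ∈ ω}) :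
    Tendsto (fun n : ℕ => (bondPercolation (zdGraph 2) (criticalProbI 2)).real {ω : BondConfig (Site 2) | ∃ x ∈ X,
        ∃ t ∈ innerBoundary (zdGraph 2) (box 2 n), ω ∈ openConnIn ((↑(box 2 n) : Set (Site 2)) \ ↑H) x t} / oneArmProb 2 (criticalProbI 2) n)
      atTop (𝓝 ((ν.map (BondConfig.relabel (sym2Equiv (Site.shift x₀)))).real {ω : BondConfig (Site 2) | (∀ e ∈ F, e ∉ ω) ∧ ∀ e ∈ G, e ∈ ω} /
        (bondPercolation (zdGraph 2) (criticalProbI 2)).real {ω : BondConfig (Site 2) | (∀ e ∈ F, e ∉ ω) ∧ ∀ e ∈ G, e ∈ ω})) := by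
  obtain ⟨ϰ, hϰ, hA2⟩ := exists_setToSetQuasiMultAspectAt_two_of_criticalProbI_le
  exact tendsto_real_conn_div_oneArmProb_at_criticalProbI (d := 2) le_rfl (by norm_num) hϰ (hA2 _ le_rfl) hν hF hG hX0 hXconn hXm hC

end Summit.CriticalPhenomena.PercolationContinuityZ3.Theorems.Crossing

end
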